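import Mathlib
import Summits.Ventures.CertifiedManyBodySolver.Theses.M3PrimeEdgeSplit

/-!
# Sketch — chord-idea-3 first lemmas (crux `M3PrimeEdgeSplit.LowerEdge_ge_m4o5`, stmt-Ventures-21721)

Two crux-idea cards (team lb-chord): `arrow-moment-efficiency` and `toeplitz-lag-anatomy`.
Only `def … : Prop` statements and one proved bookkeeping lemma; nothing here proves the crux.
Soundness of clique-sparse certificates is already typed in the registered line
`Cruxes/LowerEdge_ge_m4o5/Lines/clique_sparse_sos.lean` (`CliqueCertBound`, `blockGram`,
`LowerEdge_ge_m4o5_of`); the statements below are the ADDITIONAL first lemmas of the two levers.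
-/

open scoped ComplexOrder Matrix BigOperators

namespace Summit.Ventures.CertifiedManyBodySolver.Cruxes.LowerEdge_ge_m4o5.ChordIdea3

/-! ## Card A — arrow moment-efficiency -/

/-- Cauchy–Schwarz for PSD matrices, entrywise: the zero-solve SCREEN inequality.  From a dual-mass census
of the DIAGONAL of the optimal Gram multiplier `S ⪰ 0` (chord-eng-3 T1) it bounds the Frobenius mass of any
dropped cross block `F × F'` by `(Σ_{i∈F} S ii)(Σ_{j∈F'} S jj)` without reading off-diagonal entries. -/
def CrossMassBound : Prop :=
  ∀ (n : ℕ) (S : Matrix (Fin n) (Fin n) ℂ), S.PosSemidef →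
    ∀ i j : Fin n, ‖S i j‖ ^ 2 ≤ (S i i).re * (S j j).re

/-- Block version actually used by the screen: dropped cross mass between two disjoint index classes is at
most the product of their diagonal (trace) masses. -/
def CrossBlockMassBound : Prop :=
  ∀ (n : ℕ) (S : Matrix (Fin n) (Fin n) ℂ), S.PosSemidef →
    ∀ F F' : Finset (Fin n), Disjoint F F' →
      (∑ i ∈ F, ∑ j ∈ F', ‖S i j‖ ^ 2) ≤ (∑ i ∈ F, (S i i).re) * (∑ j ∈ F', (S j j).re)

/-- MASK-AND-REPAIR (the a-posteriori sparsification bound behind Δ_repair ≥ Δv): masking a PSD matrix to a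
pattern and adding the operator norm of the dropped part to the diagonal restores positive semidefiniteness.
Stated with an explicit bound `δ` on the dropped Hermitian part `D` (as `δ•1 ± D ⪰ 0`). -/
def MaskRepair : Prop :=
  ∀ (n : ℕ) (S D : Matrix (Fin n) (Fin n) ℂ) (δ : ℝ),
    S.PosSemidef → D.IsHermitian →
    ((δ : ℂ) • (1 : Matrix (Fin n) (Fin n) ℂ) - D).PosSemidef →
    ((S - D) + (δ : ℂ) • (1 : Matrix (Fin n) (Fin n) ℂ)).PosSemidef

/-- Proof of `MaskRepair` (pure bookkeeping: `(S - D) + δ•1 = S + (δ•1 - D)`). -/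
theorem maskRepair_holds : MaskRepair := by
  intro n S D δ hS _hD hδ
  have h : (S - D) + (δ : ℂ) • (1 : Matrix (Fin n) (Fin n) ℂ) =
      S + ((δ : ℂ) • (1 : Matrix (Fin n) (Fin n) ℂ) - D) := by abel
  rw [h]
  exact hS.add hδ

/-! ## Card B — Toeplitz lag anatomy -/

/-- The `n`-section of the block-Toeplitz matrix with matrix-valued symbol coefficients `C k`
(fibre dimension `d`): entry `((a,α),(b,β)) ↦ C (a - b) α β`.  This is the structure of a frame Gram block
indexed by (anchor position, shape) in ONE lattice direction. -/
def toeplitzSection (n d : ℕ) (C : ℤ → Matrix (Fin d) (Fin d) ℂ) :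
    Matrix (Fin n × Fin d) (Fin n × Fin d) ℂ :=
  Matrix.of fun a b => C ((a.1 : ℤ) - (b.1 : ℤ)) a.2 b.2

/-- 1-D BAND EXTENSION (operator Carathéodory–Fejér; Bakonyi–Woerdeman Thm 1.3.8 / Thm 2.3.1; Dym–Gohberg):
a PSD `(p+1)`-section of matrix-valued Toeplitz data extends, keeping the lags `|k| ≤ p`, to a PSD
`n`-section for every `n`.  Consequence for strips: Gram couplings at lags beyond the EOM reach constrain
nothing that the banded sections do not (modulo extra identifications among far moments). -/
def BandExtension1D : Prop :=
  ∀ (n d p : ℕ) (C : ℤ → Matrix (Fin d) (Fin d) ℂ),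
    (∀ k : ℤ, C (-k) = (C k)ᴴ) →
    (toeplitzSection (p + 1) d C).PosSemidef →
    ∃ C' : ℤ → Matrix (Fin d) (Fin d) ℂ,
      (∀ k : ℤ, |k| ≤ p → C' k = C k) ∧ (∀ k : ℤ, C' (-k) = (C' k)ᴴ) ∧
      (toeplitzSection n d C').PosSemidef

/-- The `R(N,N)`-section of two-level (scalar) Toeplitz data `c : ℤ × ℤ → ℂ` (anchors in an
`(N+1) × (N+1)` box): entry `(a,b) ↦ c (a - b)`. -/
def toeplitzSection2 (N : ℕ) (c : ℤ × ℤ → ℂ) :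
    Matrix (Fin (N + 1) × Fin (N + 1)) (Fin (N + 1) × Fin (N + 1)) ℂ :=
  Matrix.of fun a b => c (((a.1 : ℤ) - (b.1 : ℤ)), ((a.2 : ℤ) - (b.2 : ℤ)))

/-- 2-D OBSTRUCTION (Bakonyi–Woerdeman Thm 1.3.18; `R(2,2)` fails the extension property, via the 8 common
torus zeros of `1 - z₁²z₂²`, `z₁² - z₂²`): there are data on the lag box `[-2,2]²` whose `3 × 3`-anchor
section is PSD but which admit NO positive semidefinite extension to all larger anchor boxes.  This is the
exact sense in which a 5×5 frame's PSD constraint is weaker than translation-invariant extendability, and why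
square-frame growth at a FIXED lag set still buys (SOS-degree) content. -/
def NoExtensionR22 : Prop :=
  ∃ c : ℤ × ℤ → ℂ, (∀ k, c (-k) = star (c k)) ∧ (toeplitzSection2 2 c).PosSemidef ∧
    ¬ ∃ c' : ℤ × ℤ → ℂ, (∀ k : ℤ × ℤ, |k.1| ≤ 2 → |k.2| ≤ 2 → c' k = c k) ∧
        ∀ N : ℕ, (toeplitzSection2 N c').PosSemidef

/-- MINIMUM-REDUNDANCY SECTIONS are valid relaxations: a principal sub-section (anchors restricted to a
difference basis `e`) of a PSD section is PSD — Mathlib's `Matrix.PosSemidef.submatrix`, recorded here in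
the form the card uses. -/
theorem section_submatrix_posSemidef {m n : Type*} [Fintype m] [Fintype n]
    (M : Matrix n n ℂ) (hM : M.PosSemidef) (e : m → n) : (M.submatrix e e).PosSemidef :=
  hM.submatrix e


/-- (law kernel, r3) TWO-CLIQUE PSD COMPLETION — the one-step Grone–Johnson–Sá–Wolkowicz
fact behind «private dropped entries cost nothing»: if the clique blocks `[[A, B], [Bᴴ, C]]`
and `[[C, D], [Dᴴ, E]]` sharing the core block `C` are PSD and `C` is positive definite, then
the arrow-pattern partial matrix `[[A, B, ?], [Bᴴ, C, D], [?ᴴ, Dᴴ, E]]` completes to a PSD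
matrix with `? = B * C⁻¹ * D`.  Written with the outer split (A | C ⊕ E); stated as a Prop
(the card's typed law kernel) — the chordal case iterates it along a perfect elimination
ordering. -/
def TwoCliqueCompletion : Prop :=
  ∀ (a c e : ℕ) (A : Matrix (Fin a) (Fin a) ℂ) (B : Matrix (Fin a) (Fin c) ℂ)
    (C : Matrix (Fin c) (Fin c) ℂ) (D : Matrix (Fin c) (Fin e) ℂ) (E : Matrix (Fin e) (Fin e) ℂ),
    (Matrix.fromBlocks A B Bᴴ C).PosSemidef → (Matrix.fromBlocks C D Dᴴ E).PosSemidef →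
    C.PosDef →
    (Matrix.fromBlocks A (Matrix.fromCols B (B * C⁻¹ * D))
        (Matrix.fromCols B (B * C⁻¹ * D))ᴴ (Matrix.fromBlocks C D Dᴴ E)).PosSemidef

end Summit.Ventures.CertifiedManyBodySolver.Cruxes.LowerEdge_ge_m4o5.ChordIdea3
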